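import Summits.AnomalousDissipation.AnomalousDissipation.Theorems.TaylorGreenLoudGalerkinStates.Negative.LoadBearing
import Literature.Analysis.FluidPDE.CheskidovAssemblyTools

/-!
# Negative knowledge for the crux `GalerkinSteadyZerothLaw` (stmt-AnomalousDissipation-2986, route MirrorVariety):
# I, vocabulary, decoration, witness anatomy for a general force, scale covariance, and the shape of a kill

Certified copy of §0–§2b and §5 of the cdisprove work file `Cruxes/GalerkinSteadyZerothLaw/Disproof.lean`
(refuter-cdisprove-stmt-AnomalousDissipation-2986-0, cycle 1). Supports stmt-AnomalousDissipation-2986; nothing here asserts a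
Theses decl positively.

* §0 `BandLimited`, `SteadyState`, `FrequentlyLoud`, `LoudWitness` (dimension-generic transcriptions of the crux's clauses;
  `steadyState_iff : SteadyState ↔ TaylorGreenLoudGalerkinStates.Negative.IsSteadyState` on `T³`, `Iff.rfl`) and
  `crux_iff : GalerkinSteadyZerothLaw ↔ ∃ f, IsSmooth f ∧ IsDivFree f ∧ HasZeroMean f ∧ LoudWitness f` (`Iff.rfl`).
* §1 `loudWitness_iff_noPos` — the clause `∀ j, 0 < ν j` is decoration (forced by `0 < ε ≤ ν_j‖∇U‖²`).
* §2 `energy_identity` (`ν‖∇U‖² = ∫⟪f,U⟫`, any dimension), `loudness_le` (`ν‖∇U‖² ≤ ‖f‖₂‖U‖₂`), `sq_le_of_loud`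
  (`ε² ≤ E∫‖f‖²`), and the refuted natural strengthenings `not_loud_of_small_energy`, `not_loudWitness_zero_force`,
  `not_loud_frequently_uniform_resolution` (`∃ᶠ N, ∀ j` is false — sharpening the landed `∀ᶠ` version of crux 2987; the
  resolution floor / fixed-N / one-state facts are CITED from `TaylorGreenLoudGalerkinStates/Negative/LoadBearing.lean`).
* §2b scale covariance `(U,ν,f,E,ε) ↦ (tU,tν,t²f,t²E,t³ε)`: `steadyState_smul`, `integral_norm_sq_smul`, `gradNormSq_smul`,
  `frequentlyLoud_smul`, `loudWitness_smul`, `integral_norm_sq_pos_of_loudWitness`, and the normalisation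
  `crux_iff_normalised` (WLOG `∫‖f‖² = 1`).
* §5 `not_crux_iff` — `¬ crux` is a uniform-in-`N` laminarisation theorem for bounded steady Galerkin states under EVERY smooth
  force along EVERY `ν_j → 0⁺` (open in 3-D; its planar version is file III, `Negative/Planar.lean`).
-/

noncomputable section

open scoped InnerProductSpace Topology ComplexConjugate
open MeasureTheory Filter UnitAddTorus
open Literature.Analysis.FunctionSpaces Literature.Analysis.FunctionSpaces.Torus
open Literature.Analysis.FluidPDE

namespace Summit.AnomalousDissipation.AnomalousDissipation.Theorems.GalerkinSteadyZerothLaw.Negative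

open Summit.AnomalousDissipation.AnomalousDissipation.Theses.MirrorVariety (GalerkinSteadyZerothLaw)
open Summit.AnomalousDissipation.AnomalousDissipation.Theorems.TaylorGreenLoudGalerkinStates.Negative
  (IsBandLimited IsSteadyState resolution_floor not_loud_at_fixed_resolution not_loud_uniformly_in_resolution
    gradNormSq_le_of_isBandLimited isDivFree_zero not_loud_with_one_state)
variable {d : Type*} [Fintype d] [DecidableEq d]

/-! ## §0 Vocabulary (transparent, dimension-generic restatements of the crux's clauses) -/

/-- Band-limitation to the punctured frequency ball `0 < |k|² ≤ N²` (verbatim the crux's clause, any dimension). -/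
def BandLimited (N : ℕ) (U : UnitAddTorus d → EuclideanSpace ℝ d) : Prop :=
  ∀ k ∉ (freqBall N).erase (0 : d → ℤ), mFourierCoeff (EuclideanSpace.complexify ∘ U) k = 0

/-- Admissible Galerkin steady state at `(ν, N)` for the force `f` — verbatim the bracket of the crux (any dimension):
smooth, div-free, mean-zero, band-limited, and the tested Galerkin equations against every band-limited smooth div-free
test. -/
def SteadyState (ν : ℝ) (N : ℕ) (f U : UnitAddTorus d → EuclideanSpace ℝ d) : Prop :=
  IsSmooth U ∧ IsDivFree U ∧ HasZeroMean U ∧ BandLimited N U ∧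
    ∀ a : UnitAddTorus d → EuclideanSpace ℝ d, IsSmooth a → IsDivFree a → BandLimited N a →
      ∫ x, (⟪U x, convect U a x⟫_ℝ + ν * ⟪U x, laplacian a x⟫_ℝ + ⟪f x, a x⟫_ℝ) = 0

/-- The crux's matrix for a force `f`, a viscosity sequence and budgets: for every `j`, FREQUENTLY in `N`, a loud
bounded admissible state. -/
def FrequentlyLoud (f : UnitAddTorus d → EuclideanSpace ℝ d) (ν : ℕ → ℝ) (E ε : ℝ) : Prop :=
  ∀ j, ∃ᶠ N in atTop, ∃ U : UnitAddTorus d → EuclideanSpace ℝ d,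
    SteadyState (ν j) N f U ∧ ∫ x, ‖U x‖ ^ 2 ≤ E ∧ ε ≤ ν j * gradNormSq U

/-- The crux's conclusion for a force `f`: some positive `ν_j → 0`, some `E`, some `ε > 0` with `FrequentlyLoud`. -/
def LoudWitness (f : UnitAddTorus d → EuclideanSpace ℝ d) : Prop :=
  ∃ (ν : ℕ → ℝ) (E ε : ℝ), (∀ j, 0 < ν j) ∧ Tendsto ν atTop (𝓝 0) ∧ 0 < ε ∧ FrequentlyLoud f ν E ε

/-- On `T³` the generic bracket is, definitionally, the landed `Negative.IsSteadyState` of crux 2987. [folklore] -/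
theorem steadyState_iff (ν : ℝ) (N : ℕ) (f U : UnitAddTorus (Fin 3) → EuclideanSpace ℝ (Fin 3)) :
    SteadyState ν N f U ↔ IsSteadyState ν N f U := Iff.rfl

/-- **The crux, unfolded**: `GalerkinSteadyZerothLaw ↔ ∃ f smooth solenoidal mean-free, LoudWitness f`. [folklore] -/
theorem crux_iff :
    GalerkinSteadyZerothLaw ↔ ∃ f : UnitAddTorus (Fin 3) → EuclideanSpace ℝ (Fin 3),
      IsSmooth f ∧ IsDivFree f ∧ HasZeroMean f ∧ LoudWitness f := Iff.rfl

/-! ## §1 A hypothesis that carries no load: `0 < ν j` -/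

/-- Loudness at a positive level forces positive viscosity (`gradNormSq ≥ 0`). [folklore] -/
theorem pos_of_loud {ν ε : ℝ} {U : UnitAddTorus d → EuclideanSpace ℝ d} (hε : 0 < ε) (h : ε ≤ ν * gradNormSq U) :
    0 < ν := by
  by_contra hν
  have : ν * gradNormSq U ≤ 0 := mul_nonpos_of_nonpos_of_nonneg (not_lt.1 hν) (gradNormSq_nonneg U)
  linarith

/-- **`∀ j, 0 < ν j` is decoration**: it follows from `0 < ε` and the loudness clause (a loud state exists for every `j`
since `atTop` on `ℕ` is non-trivial). Information for the prover: positivity of the viscosities is never the issue. [folklore] -/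
theorem loudWitness_iff_noPos (f : UnitAddTorus d → EuclideanSpace ℝ d) :
    LoudWitness f ↔ ∃ (ν : ℕ → ℝ) (E ε : ℝ), Tendsto ν atTop (𝓝 0) ∧ 0 < ε ∧ FrequentlyLoud f ν E ε := by
  constructor
  · rintro ⟨ν, E, ε, -, hlim, hε, h⟩
    exact ⟨ν, E, ε, hlim, hε, h⟩
  · rintro ⟨ν, E, ε, hlim, hε, h⟩
    refine ⟨ν, E, ε, fun j => ?_, hlim, hε, h⟩
    obtain ⟨N, U, -, -, hloud⟩ := (h j).exists
    exact pos_of_loud hε hloud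

/-! ## §2 Witness anatomy for a general force -/

/-- **Energy (injection) identity**, any dimension: every admissible state at `(ν, N)` for a continuous force satisfies
`ν ‖∇U‖² = ∫ ⟪f, U⟫` (test with `a := U`; antisymmetry of the trilinear form + Green; Temam 1979 Ch. II (1.29)). [folklore] -/
theorem energy_identity {ν : ℝ} {N : ℕ} {f U : UnitAddTorus d → EuclideanSpace ℝ d}
    (hU : SteadyState ν N f U) (hf : Continuous f) :
    ν * gradNormSq U = ∫ x, ⟪f x, U x⟫_ℝ := by
  obtain ⟨hs, hdiv, -, hband, htest⟩ := hU
  have h := htest U hs hdiv hband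
  have h1 : ∫ x, ⟪U x, convect U U x⟫_ℝ = 0 := by
    have ha := integral_inner_convect_eq_neg hs hdiv hs hs
    have hc : ∫ x, ⟪convect U U x, U x⟫_ℝ = ∫ x, ⟪U x, convect U U x⟫_ℝ :=
      integral_congr_ae (ae_of_all _ fun x => real_inner_comm _ _)
    linarith
  have h2 : ∫ x, ⟪U x, laplacian U x⟫_ℝ = -gradNormSq U := by
    have hint : ∀ i, Integrable (fun x => ‖partialDeriv i U x‖ ^ 2) volume := fun i =>
      ((hs.partialDeriv i).continuous.norm.pow 2).integrable_unitAddTorus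
    rw [integral_inner_laplacian_eq_neg_holds hs, gradNormSq, integral_finsetSum _ fun i _ => hint i]
  have i1 : Integrable (fun x => ⟪U x, convect U U x⟫_ℝ) volume := (hs.inner (hs.convect hs)).integrable
  have i2 : Integrable (fun x => ν * ⟪U x, laplacian U x⟫_ℝ) volume :=
    (hs.inner hs.laplacian).integrable.const_mul ν
  have i3 : Integrable (fun x => ⟪f x, U x⟫_ℝ) volume :=
    (hf.inner hs.continuous).integrable_unitAddTorus
  have i12 : Integrable (fun x => ⟪U x, convect U U x⟫_ℝ + ν * ⟪U x, laplacian U x⟫_ℝ) volume := i1.add i2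
  rw [integral_add i12 i3, integral_add i1 i2, integral_const_mul, h1, h2] at h
  linarith

/-- **Injection ceiling for a general force**: `ν‖∇U‖² = ∫⟪f,U⟫ ≤ ‖f‖₂ ‖U‖₂` (Cauchy–Schwarz). [folklore] -/
theorem loudness_le {ν : ℝ} {N : ℕ} {f U : UnitAddTorus d → EuclideanSpace ℝ d}
    (hU : SteadyState ν N f U) (hf : Continuous f) :
    ν * gradNormSq U ≤ Real.sqrt (∫ x, ‖f x‖ ^ 2) * Real.sqrt (∫ x, ‖U x‖ ^ 2) := by
  rw [energy_identity hU hf]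
  have hfm : MemLp f 2 volume := hf.memLp_of_hasCompactSupport (HasCompactSupport.of_compactSpace _)
  have hUm : MemLp U 2 volume := hU.1.continuous.memLp_of_hasCompactSupport (HasCompactSupport.of_compactSpace _)
  exact (le_abs_self _).trans (abs_integral_inner_le_sqrt_mul_sqrt hfm hUm)

/-- **Budget window**: a loud bounded admissible state forces `ε² ≤ (∫‖f‖²) · E`. [folklore] -/
theorem sq_le_of_loud {ν E ε : ℝ} {N : ℕ} {f U : UnitAddTorus d → EuclideanSpace ℝ d}
    (hU : SteadyState ν N f U) (hf : Continuous f) (hε : 0 ≤ ε) (hE : ∫ x, ‖U x‖ ^ 2 ≤ E)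
    (hloud : ε ≤ ν * gradNormSq U) : ε ^ 2 ≤ (∫ x, ‖f x‖ ^ 2) * E := by
  have hF0 : 0 ≤ ∫ x, ‖f x‖ ^ 2 := integral_nonneg fun _ => sq_nonneg _
  have hU0 : 0 ≤ ∫ x, ‖U x‖ ^ 2 := integral_nonneg fun _ => sq_nonneg _
  have h1 := hloud.trans (loudness_le hU hf)
  have h2 : ε ^ 2 ≤ (Real.sqrt (∫ x, ‖f x‖ ^ 2) * Real.sqrt (∫ x, ‖U x‖ ^ 2)) ^ 2 := pow_le_pow_left₀ hε h1 2
  rw [mul_pow, Real.sq_sqrt hF0, Real.sq_sqrt hU0] at h2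
  exact h2.trans (mul_le_mul_of_nonneg_left hE hF0)

/-- **Natural strengthening refuted: budgets below the injection window.** For EVERY continuous force there is no loud
witness with `E · ∫‖f‖² < ε²`; the only scale-free budget of the crux is `β = ε²/(E∫‖f‖²) ∈ (0, 1]`. [folklore] -/
theorem not_loud_of_small_energy {f : UnitAddTorus d → EuclideanSpace ℝ d} (hf : Continuous f) :
    ¬ ∃ (ν : ℕ → ℝ) (E ε : ℝ), 0 < ε ∧ E * ∫ x, ‖f x‖ ^ 2 < ε ^ 2 ∧ FrequentlyLoud f ν E ε := by
  rintro ⟨ν, E, ε, hε, hE, h⟩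
  obtain ⟨N, U, hU, hUE, hloud⟩ := (h 0).exists
  have := sq_le_of_loud hU hf hε.le hUE hloud
  nlinarith

/-- **The zero force has no loud witness** (loudness = injection = 0): a proof must use `f ≠ 0` quantitatively, through
`loudness_le`. [folklore] -/
theorem not_loudWitness_zero_force : ¬ LoudWitness (fun _ : UnitAddTorus d => (0 : EuclideanSpace ℝ d)) := by
  rintro ⟨ν, E, ε, -, -, hε, h⟩
  obtain ⟨N, U, hU, -, hloud⟩ := (h 0).exists
  have hid := energy_identity hU continuous_const
  simp only [inner_zero_left, integral_zero] at hid
  linarith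

/-! ### Resolution (cited, not re-proved)

The landed `TaylorGreenLoudGalerkinStates.Negative.resolution_floor` (`ε ≤ 4π²νN²E`, Bernstein), `not_loud_at_fixed_resolution f`
(no single resolution serves all `j`) and `not_loud_uniformly_in_resolution f` (the swap `∀ᶠ N, ∀ j` is false), all general-force
on `T³` (`Theorems/TaylorGreenLoudGalerkinStates/Negative/LoadBearing.lean`), apply to `SteadyState` verbatim (`steadyState_iff` is
`Iff.rfl`), as does `not_loud_with_one_state` (the state depends on `j`). Only the `∃ᶠ` sharpening below is new. -/

/-- **Natural strengthening refuted: a `j`-uniform set of resolutions, even a sparse one** (EVERY force). The crux's `∀ j, ∃ᶠ N`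
cannot be strengthened to `∃ᶠ N, ∀ j` (sharpening the landed `not_loud_uniformly_in_resolution`, which refutes `∀ᶠ N, ∀ j`): a
single resolution would serve all `j`, against the resolution floor `ε ≤ 4π²ν_jN²E → 0`. The frequently-many `N` of the crux
necessarily drift to infinity with `j` (`N_j ≥ (ε/4π²Eν_j)^{1/2}`). [folklore] -/
theorem not_loud_frequently_uniform_resolution (f : UnitAddTorus (Fin 3) → EuclideanSpace ℝ (Fin 3)) :
    ¬ ∃ (ν : ℕ → ℝ) (E ε : ℝ), (∀ j, 0 < ν j) ∧ Tendsto ν atTop (𝓝 0) ∧ 0 < ε ∧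
        ∃ᶠ N in atTop, ∀ j, ∃ U : UnitAddTorus (Fin 3) → EuclideanSpace ℝ (Fin 3),
          SteadyState (ν j) N f U ∧ ∫ x, ‖U x‖ ^ 2 ≤ E ∧ ε ≤ ν j * gradNormSq U := by
  rintro ⟨ν, E, ε, hν, hlim, hε, h⟩
  obtain ⟨N, hN⟩ := h.exists
  exact not_loud_at_fixed_resolution f ⟨ν, E, ε, N, hν, hlim, hε, hN⟩

/-! ### §2b Scale covariance (Grashof normalisation): `(U, ν, f, E, ε) ↦ (tU, tν, t²f, t²E, t³ε)`

The tested form is homogeneous: `U ↦ tU`, `ν ↦ tν`, `f ↦ t²f` multiplies the integrand by `t²`; energy scales by `t²`, loudness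
`ν‖∇U‖²` by `t³`. So witnesses come in scaling orbits, the force may be normalised (`∫‖f‖² = 1`, `crux_iff_normalised`), and the
only scale-free budget is `β = ε²/(E∫‖f‖²) ∈ (0, 1]` (§2). Rescaling alone never produces a witness: it moves `ν_j` too. -/

/-- Scalar multiples of smooth divergence-free fields are divergence free. [folklore] -/
theorem isDivFree_const_smul {U : UnitAddTorus d → EuclideanSpace ℝ d} (hU : IsSmooth U) (hdiv : IsDivFree U) (t : ℝ) :
    IsDivFree (t • U) := by
  intro x
  have h := hdiv x
  simp only [divergence] at h ⊢
  have hcomp : ∀ i, (fun y => (t • U) y i) = t • fun y => U y i := fun i => by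
    funext y; simp [Pi.smul_apply, smul_eq_mul]
  simp_rw [hcomp, partialDeriv_const_smul ((hU.apply _).isContDiff (by simp)) t, Pi.smul_apply, smul_eq_mul,
    ← Finset.mul_sum, h, mul_zero]

omit [DecidableEq d] in
/-- `((tU)·∇)a = t (U·∇)a` (the convective derivative is linear in the advecting field). [folklore] -/
theorem convect_smul_left (t : ℝ) (U : UnitAddTorus d → EuclideanSpace ℝ d) (a : UnitAddTorus d → EuclideanSpace ℝ d)
    (x : UnitAddTorus d) : convect (t • U) a x = t • convect U a x := by
  show Torus.fderiv a x ((t • U) x) = t • Torus.fderiv a x (U x)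
  rw [Pi.smul_apply, map_smul]

omit [DecidableEq d] in
/-- Complexification commutes with real scalar multiplication of fields. [folklore] -/
theorem complexify_comp_smul (t : ℝ) (U : UnitAddTorus d → EuclideanSpace ℝ d) :
    EuclideanSpace.complexify ∘ (t • U) = (t : ℂ) • (EuclideanSpace.complexify ∘ U) := by
  funext x
  simp only [Function.comp_apply, Pi.smul_apply, map_smul]
  exact (RCLike.real_smul_eq_coe_smul (K := ℂ) t _)

/-- Band-limitation is preserved by scalar multiplication. [folklore] -/
theorem bandLimited_smul {N : ℕ} {U : UnitAddTorus d → EuclideanSpace ℝ d} (hband : BandLimited N U) (t : ℝ) :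
    BandLimited N (t • U) := by
  intro k hk
  rw [complexify_comp_smul, mFourierCoeff_const_smul, hband k hk, smul_zero]

/-- **Homogeneity of the tested steady form**: if `U` is an admissible steady state at `(ν, N)` for `f`, then `tU` is one at
`(tν, N)` for `t²f`. [folklore] -/
theorem steadyState_smul {ν : ℝ} {N : ℕ} {f U : UnitAddTorus d → EuclideanSpace ℝ d} (hU : SteadyState ν N f U) (t : ℝ) :
    SteadyState (t * ν) N ((t ^ 2) • f) (t • U) := by
  obtain ⟨hs, hdiv, hmean, hband, htest⟩ := hU
  refine ⟨hs.smul t, isDivFree_const_smul hs hdiv t, ?_, bandLimited_smul hband t, ?_⟩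
  · show ∫ x, (t • U) x = 0
    have hm : ∫ x, U x = 0 := hmean
    simp_rw [Pi.smul_apply]
    rw [integral_smul, hm, smul_zero]
  · intro a ha hdiva hbanda
    have h := htest a ha hdiva hbanda
    have hpt : (fun x => ⟪(t • U) x, convect (t • U) a x⟫_ℝ + t * ν * ⟪(t • U) x, laplacian a x⟫_ℝ +
        ⟪((t ^ 2) • f) x, a x⟫_ℝ) =
        fun x => t ^ 2 * (⟪U x, convect U a x⟫_ℝ + ν * ⟪U x, laplacian a x⟫_ℝ + ⟪f x, a x⟫_ℝ) := by
      funext x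
      rw [convect_smul_left]
      simp only [Pi.smul_apply, real_inner_smul_left, real_inner_smul_right]
      ring
    rw [hpt, integral_const_mul, h, mul_zero]

omit [DecidableEq d] in
/-- Energy scales by `t²`. [folklore] -/
theorem integral_norm_sq_smul (t : ℝ) (U : UnitAddTorus d → EuclideanSpace ℝ d) :
    ∫ x, ‖(t • U) x‖ ^ 2 = t ^ 2 * ∫ x, ‖U x‖ ^ 2 := by
  simp_rw [Pi.smul_apply, norm_smul, mul_pow, Real.norm_eq_abs, sq_abs]
  exact integral_const_mul _ _

/-- `‖∇(tU)‖² = t²‖∇U‖²` for smooth `U`. [folklore] -/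
theorem gradNormSq_smul {U : UnitAddTorus d → EuclideanSpace ℝ d} (hU : IsSmooth U) (t : ℝ) :
    gradNormSq (t • U) = t ^ 2 * gradNormSq U := by
  unfold gradNormSq
  simp_rw [partialDeriv_const_smul (hU.isContDiff (by simp)) t, Pi.smul_apply, norm_smul, mul_pow, Real.norm_eq_abs,
    sq_abs, ← Finset.mul_sum]
  exact integral_const_mul _ _

/-- **Scaling orbit of a witness**: `FrequentlyLoud f ν E ε → FrequentlyLoud (t²f) (tν) (t²E) (t³ε)` for `t > 0`. [folklore] -/
theorem frequentlyLoud_smul {f : UnitAddTorus d → EuclideanSpace ℝ d} {ν : ℕ → ℝ} {E ε : ℝ}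
    (h : FrequentlyLoud f ν E ε) {t : ℝ} (ht : 0 < t) :
    FrequentlyLoud ((t ^ 2) • f) (fun j => t * ν j) (t ^ 2 * E) (t ^ 3 * ε) := by
  intro j
  refine (h j).mono fun N => ?_
  rintro ⟨U, hU, hE, hloud⟩
  refine ⟨t • U, steadyState_smul hU t, ?_, ?_⟩
  · rw [integral_norm_sq_smul]
    exact mul_le_mul_of_nonneg_left hE (sq_nonneg t)
  · rw [gradNormSq_smul hU.1 t]
    have ht3 : 0 ≤ t ^ 3 := by positivity
    calc t ^ 3 * ε ≤ t ^ 3 * (ν j * gradNormSq U) := mul_le_mul_of_nonneg_left hloud ht3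
      _ = t * ν j * (t ^ 2 * gradNormSq U) := by ring

/-- The loud-witness property is invariant under positive rescaling of the force. [folklore] -/
theorem loudWitness_smul {f : UnitAddTorus d → EuclideanSpace ℝ d} (h : LoudWitness f) {t : ℝ} (ht : 0 < t) :
    LoudWitness ((t ^ 2) • f) := by
  obtain ⟨ν, E, ε, hν, hlim, hε, hL⟩ := h
  refine ⟨fun j => t * ν j, t ^ 2 * E, t ^ 3 * ε, fun j => mul_pos ht (hν j), ?_, by positivity, frequentlyLoud_smul hL ht⟩
  simpa using hlim.const_mul t

/-- A force with a loud witness has positive `L²` mass (by the budget window `ε² ≤ E∫‖f‖²`). [folklore] -/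
theorem integral_norm_sq_pos_of_loudWitness {f : UnitAddTorus d → EuclideanSpace ℝ d} (hf : Continuous f)
    (h : LoudWitness f) : 0 < ∫ x, ‖f x‖ ^ 2 := by
  obtain ⟨ν, E, ε, -, -, hε, hL⟩ := h
  obtain ⟨N, U, hU, hUE, hloud⟩ := (hL 0).exists
  have hw := sq_le_of_loud hU hf hε.le hUE hloud
  by_contra hF
  have hF0 : ∫ x, ‖f x‖ ^ 2 = 0 := le_antisymm (not_lt.1 hF) (integral_nonneg fun _ => sq_nonneg _)
  rw [hF0, zero_mul] at hw
  nlinarith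

/-- **Normalisation**: the crux is equivalent to its version with a UNIT force `∫‖f‖² = 1` (rescale by `t = (∫‖f‖²)^{-1/4}`).
Information for the prover: the amplitude of the force is immaterial; only the scale-free budget `ε²/(E∫‖f‖²)` and the SHAPE
of `f` matter. [folklore] -/
theorem crux_iff_normalised :
    GalerkinSteadyZerothLaw ↔ ∃ f : UnitAddTorus (Fin 3) → EuclideanSpace ℝ (Fin 3),
      IsSmooth f ∧ IsDivFree f ∧ HasZeroMean f ∧ ∫ x, ‖f x‖ ^ 2 = 1 ∧ LoudWitness f := by
  rw [crux_iff]
  constructor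
  · rintro ⟨f, hf, hdiv, hmean, hW⟩
    set F : ℝ := ∫ x, ‖f x‖ ^ 2 with hFdef
    have hF : 0 < F := integral_norm_sq_pos_of_loudWitness hf.continuous hW
    set t : ℝ := 1 / Real.sqrt (Real.sqrt F) with htdef
    have hsF : 0 < Real.sqrt F := Real.sqrt_pos.2 hF
    have ht : 0 < t := by positivity
    have ht2 : t ^ 2 = 1 / Real.sqrt F := by
      rw [htdef, div_pow, one_pow, Real.sq_sqrt hsF.le]
    have ht4 : t ^ 4 * F = 1 := by
      have : t ^ 4 = (t ^ 2) ^ 2 := by ring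
      rw [this, ht2, div_pow, one_pow, Real.sq_sqrt hF.le, one_div, inv_mul_cancel₀ hF.ne']
    refine ⟨(t ^ 2) • f, hf.smul _, isDivFree_const_smul hf hdiv _, ?_, ?_, loudWitness_smul hW ht⟩
    · show ∫ x, ((t ^ 2) • f) x = 0
      have hm : ∫ x, f x = 0 := hmean
      simp_rw [Pi.smul_apply]
      rw [integral_smul, hm, smul_zero]
    · rw [integral_norm_sq_smul, ← hFdef, ← ht4]
      ring
  · rintro ⟨f, hf, hdiv, hmean, -, hW⟩
    exact ⟨f, hf, hdiv, hmean, hW⟩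

/-! ## §5 What a refutation must prove -/

/-- **The negation of the crux, unfolded (pure logic).** `¬ crux` says: for EVERY smooth solenoidal mean-free force, along
EVERY positive sequence `ν_j → 0` and for all `E`, `ε > 0`, some `j` has, for ALL LARGE resolutions `N`, only quiet
(`ν_j‖∇U‖² < ε`) admissible states of energy `≤ E` — a uniform-in-`N` laminarisation theorem for bounded steady Galerkin
states under arbitrary smooth forcing (route CoherentStates' `SteadyNeg` at the Galerkin level, for all forces at once).
Nothing of the kind is known in 3-D; in 2-D it is `not_galerkinSteadyZerothLaw2D` (§4). [folklore] -/
theorem not_crux_iff :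
    ¬ GalerkinSteadyZerothLaw ↔
      ∀ f : UnitAddTorus (Fin 3) → EuclideanSpace ℝ (Fin 3), IsSmooth f → IsDivFree f → HasZeroMean f →
        ∀ (ν : ℕ → ℝ) (E ε : ℝ), (∀ j, 0 < ν j) → Tendsto ν atTop (𝓝 0) → 0 < ε →
          ∃ j, ∀ᶠ N in atTop, ∀ U : UnitAddTorus (Fin 3) → EuclideanSpace ℝ (Fin 3),
            SteadyState (ν j) N f U → ∫ x, ‖U x‖ ^ 2 ≤ E → ν j * gradNormSq U < ε := by
  rw [crux_iff]
  constructor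
  · intro h f hf hdiv hmean ν E ε hν hlim hε
    by_contra hc
    refine h ⟨f, hf, hdiv, hmean, ν, E, ε, hν, hlim, hε, fun j => ?_⟩
    have hj : ¬ ∀ᶠ N in atTop, ∀ U : UnitAddTorus (Fin 3) → EuclideanSpace ℝ (Fin 3),
        SteadyState (ν j) N f U → ∫ x, ‖U x‖ ^ 2 ≤ E → ν j * gradNormSq U < ε := fun hf' => hc ⟨j, hf'⟩
    rw [Filter.not_eventually] at hj
    refine hj.mono fun N hN => ?_
    by_contra hU
    refine hN fun U hS hE => ?_
    by_contra hlt
    exact hU ⟨U, hS, hE, not_lt.1 hlt⟩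
  · rintro h ⟨f, hf, hdiv, hmean, ν, E, ε, hν, hlim, hε, hL⟩
    obtain ⟨j, hj⟩ := h f hf hdiv hmean ν E ε hν hlim hε
    obtain ⟨N, ⟨U, hS, hE, hloud⟩, hN⟩ := ((hL j).and_eventually hj).exists
    exact absurd (hN U hS hE) (not_lt.2 hloud)

end Summit.AnomalousDissipation.AnomalousDissipation.Theorems.GalerkinSteadyZerothLaw.Negative

end
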